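import Summits.QuantumFields.YangMills.Theorems.UnitScaleTiltProp7Crit93OfEq111T3
import Summits.QuantumFields.YangMills.Theorems.UnitScaleTiltProp7SectET3RealityPInvJTermT3
import HarnessLib

/-!
# Route `UnitScaleTilt`, crux «MinimiserStabilityRegPr» (stmt-QuantumFields-19200, stub EX `stub_existenceMinimalOrbit`, route (α)) — «HDELTA-SYMM»: **THE ROWS `hΔ`, `hΔ₁` OF THE LATTICE
# (84) AT THE T³ MEMBER** — symmetry of `Δ_πᴾ` and `Δ₁ᴾ` as (27)-BILINEAR forms, `pair27 tr (T̂ Y) (flat115 Z) = pair27 tr (T̂ Z) (flat115 Y)`, in the currency of lit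
# `B11Eq81ExpansionZpow.hasDerivAt_actionZ_chartRay_real`'s hypotheses `hΔ hΔ₁ : ∀ Y Z, pair27 τ (Δ Y) (flat115 Z) = pair27 τ (Δ Z) (flat115 Y)`, from «`T` symmetric» + «`T` real (σ-row)»

Cell `ym3-torus` (HUMAN RULING D-0037, YM ladder rung R3 — YM₃ on T³, NOT d = 4, NOT Clay; YM gap NOT proved), width seat `ym3-torus-px21` gen 2 (explicit-unit helper; lineage `hCrit93′`:
✓`Prop7Crit93OfEq111` … ✓`Prop7Row79AtMemberPInv`).  THEOREMS ONLY (0 `def`, 0 `sorry`); `--supports stmt-QuantumFields-19200 --as helper`, count-neutral; NO claim on crux ∕ stub ∕ registry.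

THE PRINT.  [Balaban1985BackgroundPropagators] p. 392: «For U with values in the unitary group U(N) it [Δ] is a hermitian operator given by the quadratic form ⟨A, ΔA⟩ …» (3.10)–(3.12);
(3.119) p. 419 and (3.127)–(3.128) p. 421 define `Δ_π`, `Δ₁` by REAL SYMMETRIC quadratic forms on real (`𝔤`-valued) fields; [Balaban1985Variational] (81)∕(84) p. 290 use `⟨δA′, Δ₁A′⟩ =
⟨A′, Δ₁δA′⟩`.  In the tree the operators live on the complexified weighted `L²` space; the (27)-pairing `pair27 tr K (flat115 Z) = η³c₀⁻¹⟪toL2 (ιZ)ᴴ, toL2 K♭⟫` (✓`pair27_eq_inner_toL2`) is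
ℂ-BILINEAR, so its symmetry for `K := T̂Y` needs BOTH the Hermitian symmetry of `T` (`IsSymmetric`) AND its reality (the σ-row `T(toL2 Xᴴ) = toL2 (toL2⁻¹(T toL2 X))ᴴ`), plus `tr(AB) = tr(BA)`.

WHAT IS PROVED (member `F`, `K n`; ns `…Theorems.Prop7PairingSymmetryAtMember`):
* §1 ★`inner_toL2_star_comm` — `⟪toL2 Wᴴ, toL2 X⟫ = ⟪toL2 Xᴴ, toL2 W⟫` (trace cyclicity); ★★★**`pair27_currentCLM_symm_of_rows (T) (hTsymm : T.IsSymmetric) (hTσ : σ-row) (Y Z) :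
  pair27 tr (currentCLM … T Y) (flat115 Z) = pair27 tr (currentCLM … T Z) (flat115 Y)`** — GENERIC IN THE SLOT.
* §2 the instances at the pinv letters of the display of record S9′, UNCONDITIONAL at `U₀ ∈ 𝔘_k(ε₀)` in the windows `10⁹L²e ≤ 1`, `10¹²L³ε₀ ≤ 1`, `0 ≤ a`: ★★`hDelta_member_DeltaPiSlotP`
  (✓`DeltaPiP_isSymmetric` + ✓`DeltaPiSlotP_toL2_star_of_regPr`, ym3-torus-px3 (P3) part 1) and ★★`hDelta1_member_DeltaOnePJ` (✓`DeltaOnePJ_reality_rows_at_regPr`, (P3) part 2b) — lit's `hΔ`, `hΔ₁`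
  at `Δπ := currentCLM … (DeltaPiSlotP … U₀)`, `Δ₁ := currentCLM … (DeltaOnePJ … U₀)`.
HONEST SCOPE.  Linear algebra over landed letters; no estimate; not a proof of any stub; nothing continuum ∕ OS ∕ mass-gap ∕ Clay.

References: T. Bałaban, CMP **99** (1985) 389–434 [Balaban1985BackgroundPropagators] ((3.10)–(3.12) p.392, (3.119) p.419, (3.127)–(3.128) p.421); CMP **102** (1985) 277–309 [Balaban1985Variational]
((27) p.282, (81), (84) p.290).
-/

set_option autoImplicit false

noncomputable section

open scoped InnerProductSpace ComplexConjugate Matrix.Norms.L2Operator BigOperators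

namespace Summit.QuantumFields.YangMills.Theorems.Prop7PairingSymmetryAtMember

open Literature.MathematicalPhysics.QuantumFieldTheory.Balaban1983to89
open Literature.MathematicalPhysics.QuantumFieldTheory.Balaban1983to89.T3ContinuumYM3Torus
open T3SectALandauChart (eta eta_pos)
open T3PrintedRegularMinimiser (RegPr)
open B9SectCLatticeCarrier (Bond)
open B11Eq115Space (NegSize Space115 JetSup NegSup)
open B11Eq111FrakG (nabla115)
open B11Eq103H1Complex (SiteL2K BondL2K funEquiv)
open B11Eq90Transpose (pair27)
open B11Eq90V0primeCurrent (flat115 flat115_apply)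
open B9Eq3119DeltaPiCarrier (currentCLM)
open Summit.QuantumFields.YangMills.Theorems.Prop7SectET3Transport (periodsT3 bondEquiv bgOfCfg)
open Summit.QuantumFields.YangMills.Theorems.Prop7SectET3HilbertLetters (W₂ frobEquiv toL2 inner_toL2)
open Summit.QuantumFields.YangMills.Theorems.Prop7SectET3DeltaPiPInv (DeltaPiP DeltaPiSlotP DeltaPiSlotP_apply DeltaPiP_isSymmetric)
open Summit.QuantumFields.YangMills.Theorems.Prop7SectET3DeltaOnePInv (DeltaOnePJ)
open Summit.QuantumFields.YangMills.Theorems.Prop7SectET3RealityPInv (DeltaPiSlotP_toL2_star_of_regPr)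
open Summit.QuantumFields.YangMills.Theorems.Prop7SectET3RealityPInvJTerm (DeltaOnePJ_reality_rows_at_regPr)
open Summit.QuantumFields.YangMills.Theorems.Prop7Crit93OfEq111 (pair27_eq_inner_toL2 toL2_currentCLM)

variable {F : T3Family} {n K : ℕ} {h : n ≤ K} {c₀ cB a : ℝ} [Fact (0 < c₀)] [Fact (0 < cB)]

/-! ## §1 Trace cyclicity in `L²` letters and the generic symmetry of the (27)-pairing of an operator current -/

omit [Fact (0 < cB)] in
/-- ★ **`⟪toL2 Wᴴ, toL2 X⟫ = ⟪toL2 Xᴴ, toL2 W⟫`** — both equal `c₀·Σ_b tr(W(b)X(b))` (`tr(AB) = tr(BA)`). [cite: Balaban1985BackgroundPropagators, (3.11) p.392] -/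
theorem inner_toL2_star_comm (W X : PBond (F.P K) 0 → Matrix (Fin 2) (Fin 2) ℂ) :
    ⟪toL2 F K c₀ (star W), toL2 F K c₀ X⟫_ℂ = ⟪toL2 F K c₀ (star X), toL2 F K c₀ W⟫_ℂ := by
  rw [inner_toL2, inner_toL2]
  congr 1
  refine Finset.sum_congr rfl fun b _ => ?_
  rw [Pi.star_apply, Pi.star_apply, Matrix.star_eq_conjTranspose, Matrix.star_eq_conjTranspose, Matrix.conjTranspose_conjTranspose, Matrix.conjTranspose_conjTranspose,
    Matrix.trace_mul_comm]

variable [Fact (0 < (F.L : ℝ))] [Fact (0 < ((F.L : ℝ)⁻¹) ^ (K - n))]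

omit [Fact (0 < cB)] in
/-- ★★★ **THE (27)-PAIRING OF AN OPERATOR CURRENT IS SYMMETRIC WHEN THE OPERATOR IS SYMMETRIC AND REAL**: for an `L²` operator `T` with `⟪Tx, y⟫ = ⟪x, Ty⟫` (`hTsymm`) and the σ-row
`T(toL2 (toL2⁻¹f)ᴴ) = toL2 (toL2⁻¹(T f))ᴴ` (`hTσ`), `pair27 tr (T̂ Y) (flat115 Z) = pair27 tr (T̂ Z) (flat115 Y)` for ALL (115)-fields `Y Z` (`T̂ := currentCLM … T`) — the shape of lit's rows `hΔ`, `hΔ₁`.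
[cite: Balaban1985BackgroundPropagators, (3.10)–(3.12) p.392; Balaban1985Variational, (27) p.282, (81) p.290] -/
theorem pair27_currentCLM_symm_of_rows (U₀ : GaugeField (F.P K) 0 (Matrix.specialUnitaryGroup (Fin 2) ℂ))
    (T : BondL2K ℂ 3 (periodsT3 F K) c₀ W₂ →ₗ[ℂ] BondL2K ℂ 3 (periodsT3 F K) c₀ W₂) (hTsymm : T.IsSymmetric)
    (hTσ : ∀ f : BondL2K ℂ 3 (periodsT3 F K) c₀ W₂, T (toL2 F K c₀ (star ((toL2 F K c₀).symm f))) = toL2 F K c₀ (star ((toL2 F K c₀).symm (T f))))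
    (Y Z : Space115 (F.L : ℝ) (((F.L : ℝ)⁻¹) ^ (K - n)) (fun _ : Bond 3 (periodsT3 F K) => K - n) (fun _ : Bond 3 (periodsT3 F K) × Fin 3 => K - n)
      (nabla115 (((F.L : ℝ)⁻¹) ^ (K - n)) (bgOfCfg F K U₀))) :
    pair27 (LinearMap.toContinuousLinearMap (Matrix.traceLinearMap (Fin 2) ℂ ℂ))
        (currentCLM frobEquiv (fun _ : Bond 3 (periodsT3 F K) × Fin 3 => K - n) (nabla115 (((F.L : ℝ)⁻¹) ^ (K - n)) (bgOfCfg F K U₀)) T Y) (flat115 Z)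
      = pair27 (LinearMap.toContinuousLinearMap (Matrix.traceLinearMap (Fin 2) ℂ ℂ))
          (currentCLM frobEquiv (fun _ : Bond 3 (periodsT3 F K) × Fin 3 => K - n) (nabla115 (((F.L : ℝ)⁻¹) ^ (K - n)) (bgOfCfg F K U₀)) T Z) (flat115 Y) := by
  have hY : (fun b : PBond (F.P K) 0 => flat115 Y (bondEquiv F K b)) = fun b : PBond (F.P K) 0 => JetSup.equiv _ _ _ Y (bondEquiv F K b) := rfl
  have hZ : (fun b : PBond (F.P K) 0 => flat115 Z (bondEquiv F K b)) = fun b : PBond (F.P K) 0 => JetSup.equiv _ _ _ Z (bondEquiv F K b) := rfl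
  rw [pair27_eq_inner_toL2 (c₀ := c₀), pair27_eq_inner_toL2 (c₀ := c₀), toL2_currentCLM, toL2_currentCLM, hY, hZ]
  congr 2
  -- `⟪(ιZ)ᴴ, T ιY⟫ = ⟪T (ιZ)ᴴ, ιY⟫ = ⟪(toL2⁻¹(T ιZ))ᴴ, ιY⟫ = ⟪(ιY)ᴴ, toL2⁻¹(T ιZ)⟫ = ⟪(ιY)ᴴ, T ιZ⟫`
  have h1 := hTσ (toL2 F K c₀ (fun b : PBond (F.P K) 0 => JetSup.equiv _ _ _ Z (bondEquiv F K b)))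
  rw [LinearEquiv.symm_apply_apply] at h1
  rw [← hTsymm, h1, inner_toL2_star_comm, LinearEquiv.apply_symm_apply]

/-! ## §2 The instances at the pinv letters of the display of record -/

/-- ★★ **lit's ROW `hΔ` AT THE MEMBER: `Δ_πᴾ` IS SYMMETRIC AS A (27)-BILINEAR FORM** at `U₀ ∈ 𝔘_k(ε₀)` in the windows (`0 ≤ a`): `IsSymmetric` ✓`DeltaPiP_isSymmetric` + σ-row
✓`DeltaPiSlotP_toL2_star_of_regPr`. [cite: Balaban1985BackgroundPropagators, (3.119) p.419, (3.12) p.392; Balaban1985Variational, (81) p.290] -/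
theorem hDelta_member_DeltaPiSlotP (ha : 0 ≤ a) {ε₀ e : ℝ} (hε₀ : 0 < ε₀) (he : 0 < e) (hWe : 10 ^ 9 * (F.L : ℝ) ^ 2 * e ≤ 1) (hWε : 10 ^ 12 * (F.L : ℝ) ^ 3 * ε₀ ≤ 1)
    (U₀ : GaugeField (F.P K) 0 (Matrix.specialUnitaryGroup (Fin 2) ℂ)) (hreg : RegPr F n K ε₀ U₀) :
    ∀ Y Z : Space115 (F.L : ℝ) (((F.L : ℝ)⁻¹) ^ (K - n)) (fun _ : Bond 3 (periodsT3 F K) => K - n) (fun _ : Bond 3 (periodsT3 F K) × Fin 3 => K - n)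
        (nabla115 (((F.L : ℝ)⁻¹) ^ (K - n)) (bgOfCfg F K U₀)),
      pair27 (LinearMap.toContinuousLinearMap (Matrix.traceLinearMap (Fin 2) ℂ ℂ))
          (currentCLM frobEquiv (fun _ : Bond 3 (periodsT3 F K) × Fin 3 => K - n) (nabla115 (((F.L : ℝ)⁻¹) ^ (K - n)) (bgOfCfg F K U₀)) (DeltaPiSlotP F n K h c₀ cB a U₀) Y) (flat115 Z)
        = pair27 (LinearMap.toContinuousLinearMap (Matrix.traceLinearMap (Fin 2) ℂ ℂ))
            (currentCLM frobEquiv (fun _ : Bond 3 (periodsT3 F K) × Fin 3 => K - n) (nabla115 (((F.L : ℝ)⁻¹) ^ (K - n)) (bgOfCfg F K U₀)) (DeltaPiSlotP F n K h c₀ cB a U₀) Z) (flat115 Y) :=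
  fun Y Z => pair27_currentCLM_symm_of_rows U₀ _ (by rw [DeltaPiSlotP_apply]; exact DeltaPiP_isSymmetric U₀)
    (DeltaPiSlotP_toL2_star_of_regPr F n K h c₀ cB a U₀ ha hε₀ he hWe hWε hreg) Y Z

/-- ★★ **lit's ROW `hΔ₁` AT THE MEMBER: `Δ₁ᴾ` IS SYMMETRIC AS A (27)-BILINEAR FORM** at `U₀ ∈ 𝔘_k(ε₀)` in the windows (`0 ≤ a`): σ-row ∧ symmetry from
✓`DeltaOnePJ_reality_rows_at_regPr`. [cite: Balaban1985BackgroundPropagators, (3.127)–(3.128) p.421; Balaban1985Variational, (81), (84) p.290] -/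
theorem hDelta1_member_DeltaOnePJ (ha : 0 ≤ a) {ε₀ e : ℝ} (hε₀ : 0 < ε₀) (he : 0 < e) (hWe : 10 ^ 9 * (F.L : ℝ) ^ 2 * e ≤ 1) (hWε : 10 ^ 12 * (F.L : ℝ) ^ 3 * ε₀ ≤ 1)
    (U₀ : GaugeField (F.P K) 0 (Matrix.specialUnitaryGroup (Fin 2) ℂ)) (hreg : RegPr F n K ε₀ U₀) :
    ∀ Y Z : Space115 (F.L : ℝ) (((F.L : ℝ)⁻¹) ^ (K - n)) (fun _ : Bond 3 (periodsT3 F K) => K - n) (fun _ : Bond 3 (periodsT3 F K) × Fin 3 => K - n)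
        (nabla115 (((F.L : ℝ)⁻¹) ^ (K - n)) (bgOfCfg F K U₀)),
      pair27 (LinearMap.toContinuousLinearMap (Matrix.traceLinearMap (Fin 2) ℂ ℂ))
          (currentCLM frobEquiv (fun _ : Bond 3 (periodsT3 F K) × Fin 3 => K - n) (nabla115 (((F.L : ℝ)⁻¹) ^ (K - n)) (bgOfCfg F K U₀)) (DeltaOnePJ F n K h c₀ cB a U₀) Y) (flat115 Z)
        = pair27 (LinearMap.toContinuousLinearMap (Matrix.traceLinearMap (Fin 2) ℂ ℂ))
            (currentCLM frobEquiv (fun _ : Bond 3 (periodsT3 F K) × Fin 3 => K - n) (nabla115 (((F.L : ℝ)⁻¹) ^ (K - n)) (bgOfCfg F K U₀)) (DeltaOnePJ F n K h c₀ cB a U₀) Z) (flat115 Y) :=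
  fun Y Z => by
    obtain ⟨hσ, -, hsymm⟩ := DeltaOnePJ_reality_rows_at_regPr F n K h c₀ cB a U₀ ha hε₀ he hWe hWε hreg
    exact pair27_currentCLM_symm_of_rows U₀ _ hsymm hσ Y Z

end Summit.QuantumFields.YangMills.Theorems.Prop7PairingSymmetryAtMember

end
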